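import Summits.Parity.GeneralizedHardyLittlewood.Theorems.FordMaynardSieveConst01651SieveConst01651Dim5Check
import Summits.Parity.GeneralizedHardyLittlewood.Theorems.FordMaynardSieveConst01651SieveConst01651Witness
import HarnessLib

/-!
# Route `FordMaynardSieveConst01651`, target `SieveConst01651` (stmt-Parity-19185), stub `stub_coneCertClosed`,
# residue `h5`: the packed table agrees with the tree table (rows 24–35; out-of-range; `g₃`)

Def-free helper file.  `g2Fast` (21-bit digits of the 36 packed naturals `g2Rows` of `…Dim5Data`) coincides with
`g2Lookup` (`List.find?` in `certG2`) — row by row by kernel evaluation (`decide`, 168 tree lookups per row, ≈ 12 s of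
kernel time each), and identically `0` outside `a ≤ 35, b ≤ 83, j ≤ 1` by the table fact `certG2_fst_le`.  This links the
dimension-5 type checker to the witness `coneCert` (assembled as `g2Fast_eq_g2Lookup` in `…Dim5Final`).

References: [FordMaynard2024PrimeSieves] arXiv:2407.14368, §8.2.
-/

namespace Summit.Parity.GeneralizedHardyLittlewood.FordMaynardSieveConst01651SieveConst01651

/-- Row `24` of the packed table agrees with `certG2` (kernel evaluation). [folklore] -/
theorem g2Fast_row_24 : ∀ b, b ≤ 83 → ∀ j, j ≤ 1 → g2Fast 24 b j = g2Lookup 24 b j := by decide +kernel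

/-- Row `25` of the packed table agrees with `certG2` (kernel evaluation). [folklore] -/
theorem g2Fast_row_25 : ∀ b, b ≤ 83 → ∀ j, j ≤ 1 → g2Fast 25 b j = g2Lookup 25 b j := by decide +kernel

/-- Row `26` of the packed table agrees with `certG2` (kernel evaluation). [folklore] -/
theorem g2Fast_row_26 : ∀ b, b ≤ 83 → ∀ j, j ≤ 1 → g2Fast 26 b j = g2Lookup 26 b j := by decide +kernel

/-- Row `27` of the packed table agrees with `certG2` (kernel evaluation). [folklore] -/
theorem g2Fast_row_27 : ∀ b, b ≤ 83 → ∀ j, j ≤ 1 → g2Fast 27 b j = g2Lookup 27 b j := by decide +kernel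

/-- Row `28` of the packed table agrees with `certG2` (kernel evaluation). [folklore] -/
theorem g2Fast_row_28 : ∀ b, b ≤ 83 → ∀ j, j ≤ 1 → g2Fast 28 b j = g2Lookup 28 b j := by decide +kernel

/-- Row `29` of the packed table agrees with `certG2` (kernel evaluation). [folklore] -/
theorem g2Fast_row_29 : ∀ b, b ≤ 83 → ∀ j, j ≤ 1 → g2Fast 29 b j = g2Lookup 29 b j := by decide +kernel

/-- Row `30` of the packed table agrees with `certG2` (kernel evaluation). [folklore] -/
theorem g2Fast_row_30 : ∀ b, b ≤ 83 → ∀ j, j ≤ 1 → g2Fast 30 b j = g2Lookup 30 b j := by decide +kernel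

/-- Row `31` of the packed table agrees with `certG2` (kernel evaluation). [folklore] -/
theorem g2Fast_row_31 : ∀ b, b ≤ 83 → ∀ j, j ≤ 1 → g2Fast 31 b j = g2Lookup 31 b j := by decide +kernel

/-- Row `32` of the packed table agrees with `certG2` (kernel evaluation). [folklore] -/
theorem g2Fast_row_32 : ∀ b, b ≤ 83 → ∀ j, j ≤ 1 → g2Fast 32 b j = g2Lookup 32 b j := by decide +kernel

/-- Row `33` of the packed table agrees with `certG2` (kernel evaluation). [folklore] -/
theorem g2Fast_row_33 : ∀ b, b ≤ 83 → ∀ j, j ≤ 1 → g2Fast 33 b j = g2Lookup 33 b j := by decide +kernel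

/-- Row `34` of the packed table agrees with `certG2` (kernel evaluation). [folklore] -/
theorem g2Fast_row_34 : ∀ b, b ≤ 83 → ∀ j, j ≤ 1 → g2Fast 34 b j = g2Lookup 34 b j := by decide +kernel

/-- Row `35` of the packed table agrees with `certG2` (kernel evaluation). [folklore] -/
theorem g2Fast_row_35 : ∀ b, b ≤ 83 → ∀ j, j ≤ 1 → g2Fast 35 b j = g2Lookup 35 b j := by decide +kernel

/-- Outside `a ≤ 35`, `b ≤ 83`, `j ≤ 1` the tree lookup is `0` (every entry of `certG2` has `a ≤ 35`, `b ≤ 83`, `j ≤ 1`).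
[folklore] -/
theorem g2Lookup_eq_zero_of_out {a b j : ℕ} (h : ¬(a ≤ 35 ∧ b ≤ 83 ∧ j ≤ 1)) : g2Lookup a b j = 0 := by
  unfold g2Lookup
  split
  · rename_i e he
    exfalso
    have hmem := List.mem_of_find?_eq_some he
    have hpred := List.find?_some he
    have hall := certG2_fst_le
    rw [List.all_eq_true] at hall
    have h1 := hall e hmem
    simp only [Bool.and_eq_true, beq_iff_eq, decide_eq_true_eq] at hpred h1
    omega
  · rfl

/-- Outside the same range the packed lookup is `0` too. [folklore] -/
theorem g2Fast_eq_zero_of_out {a b j : ℕ} (h : ¬(a ≤ 35 ∧ b ≤ 83 ∧ j ≤ 1)) : g2Fast a b j = 0 := by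
  unfold g2Fast
  rw [if_neg h]

/-- `g3Fast = g3Lookup`. [folklore] -/
theorem g3Fast_eq_g3Lookup (a b c : ℕ) : g3Fast a b c = g3Lookup a b c := by
  unfold g3Fast g3Lookup
  by_cases ha : a = 0 <;> by_cases hb : b = 0 <;> by_cases hc : c = 0 <;> by_cases hc1 : c = 1 <;>
    simp [ha, hb, hc, hc1]

end Summit.Parity.GeneralizedHardyLittlewood.FordMaynardSieveConst01651SieveConst01651
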